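import Summits.RiemannHypothesis.RiemannHypothesis.Theorems.JensenLogBandFarZoneCompetitorXi
import HarnessLib

/-!
# [SUP] — the competitor half-arc transform bounded by a sup (BAND crux, lead's division of labour)

RH ladder column JENSEN, rung J-P(P3) «log band», BAND crux `XiDerivBandRealAllRates`
(stmt-RiemannHypothesis-19913) of route «JensenLogBand», line «band-one-window» (top-shell reshape,
BAND lead rh-jensen-prover g8; stubs `stub_shellNear` / `stub_shellFar`). This is the item [SUP]
of the lead's division of labour (STATUS 04:42:25Z), in the requested shape. RH-FREE. WHAT THIS
IS NOT: nothing here bears on zeros of `ζ` or the truth of RH.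

For a competitor centre `c' = x' + iT` (`|x'| ≤ ½`) and radius `0 < h ≤ 20` whose right half-arc
lies left of `1 + δ` (`½ + x' + h ≤ 1 + δ`, `0 < δ ≤ 1`), `T ≥ 1200`:

* `norm_sqKernel_arc_le` — `‖K_{n,c'}(u_θ)‖ ≤ 2(T + h + 1)/(h(2T − h))^{n+1}` on the whole circle;
* `norm_arcIntegrandU_arc_le` — `‖arcIntegrandU n h c' θ‖ ≤ h·[672·log(T+h)·e^{(4/5)h}·‖γ̃(1+δ+iT)‖]·
  [2(T+h+1)/(h(2T−h))^{n+1}]` for `|θ| ≤ π/2` (F7a = flat majorant F2 + vertical γ̃);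
* **`norm_xiSqArcU_competitor_le`** — `‖U_{n,h}(c')‖ ≤ (n!/2)·h·672·log(T+h)·e^{(4/5)h}·‖γ̃(1+δ+iT)‖·
  2(T+h+1)/(h(2T−h))^{n+1}` (`U = (n!/2πi)∫_{−π/2}^{π/2} arcIntegrandU`, length `π`).

(prover-rh-jensen-eng-2-g6-0, 2026-08-27.)
-/

noncomputable section

-- single-problem summit: `Summit.RiemannHypothesis.RiemannHypothesis.…` is the tree convention
set_option linter.dupNamespace false

open Complex Real Set

namespace Summit.RiemannHypothesis.RiemannHypothesis.Theorems.JensenPolynomials.LogBandArc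

open Literature.NumberTheory.LFunctions

/-- **The kernel on a competitor circle:** for `|x'| ≤ ½`, `0 < h ≤ 20`, `T ≥ 1200` and any `θ`,
with `u_θ = (x'+iT) + h e^{iθ}`: `‖K_{n,c'}(u_θ)‖ ≤ 2(T + h + 1)/(h(2T − h))^{n+1}`
(`‖u_θ‖ ≤ T + h + ½`, `‖u_θ − c'‖ = h`, `‖u_θ + c'‖ ≥ Im = 2T + h sin θ ≥ 2T − h`). RH-FREE.
[folklore] -/
theorem norm_sqKernel_arc_le {x' h T : ℝ} (n : ℕ) (hx' : |x'| ≤ 1 / 2) (hh0 : 0 < h) (hH : h ≤ 20)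
    (hT : 1200 ≤ T) (θ : ℝ) :
    ‖sqKernel n ((x' : ℂ) + (T : ℂ) * I) (circleMap ((x' : ℂ) + (T : ℂ) * I) h θ)‖ ≤
      2 * (T + h + 1) / (h * (2 * T - h)) ^ (n + 1) := by
  have hx'' := abs_le.1 hx'
  have hsin := abs_le.1 (Real.abs_sin_le_one θ)
  have hwc : ‖circleMap ((x' : ℂ) + (T : ℂ) * I) h θ - ((x' : ℂ) + (T : ℂ) * I)‖ = h := by
    rw [circleMap_sub_center, norm_circleMap_zero, abs_of_pos hh0]
  have hwim := (circleMap_sub_re_im ((x' : ℂ) + (T : ℂ) * I) h θ).2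
  have hc'im : ((x' : ℂ) + (T : ℂ) * I).im = T := by simp
  have hnc' : ‖(x' : ℂ) + (T : ℂ) * I‖ ≤ 1 / 2 + T := by
    calc ‖(x' : ℂ) + (T : ℂ) * I‖ ≤ ‖(x' : ℂ)‖ + ‖(T : ℂ) * I‖ := norm_add_le _ _
      _ ≤ 1 / 2 + T := by
          rw [norm_mul, Complex.norm_I, mul_one, Complex.norm_real, Complex.norm_real,
            Real.norm_eq_abs, Real.norm_eq_abs, abs_of_nonneg (show (0 : ℝ) ≤ T by linarith only [hT])]
          linarith only [hx']
  generalize hc : ((x' : ℂ) + (T : ℂ) * I) = c at *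
  generalize hw : circleMap c h θ = w at *
  rw [norm_sqKernel_eq, hwc]
  -- numerator
  have hw_norm : ‖w‖ ≤ T + h + 1 := by
    have := norm_add_le c (w - c)
    rw [show c + (w - c) = w by ring, hwc] at this
    linarith only [this, hnc']
  -- denominator
  have hwcim : 2 * T - h ≤ (w + c).im := by
    have e : (w + c).im = (w - c).im + 2 * T := by rw [Complex.add_im, Complex.sub_im, hc'im]; ring
    rw [e, hwim]; nlinarith only [hsin.1, hh0]
  have hwcn : 2 * T - h ≤ ‖w + c‖ := by
    have := Complex.abs_im_le_norm (w + c)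
    rw [abs_of_pos (by linarith only [hwcim, hT, hH])] at this
    linarith only [this, hwcim]
  have hden : (h * (2 * T - h)) ^ (n + 1) ≤ (h * ‖w + c‖) ^ (n + 1) :=
    pow_le_pow_left₀ (by nlinarith only [hh0, hT, hH]) (mul_le_mul_of_nonneg_left hwcn hh0.le) _
  have hden0 : 0 < (h * (2 * T - h)) ^ (n + 1) := by
    apply pow_pos; nlinarith only [hh0, hT, hH]
  calc 2 * ‖w‖ / (h * ‖w + c‖) ^ (n + 1) ≤ 2 * (T + h + 1) / (h * ‖w + c‖) ^ (n + 1) := by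
        apply div_le_div_of_nonneg_right _ (hden0.le.trans hden)
        linarith only [hw_norm]
    _ ≤ 2 * (T + h + 1) / (h * (2 * T - h)) ^ (n + 1) := by
        apply div_le_div_of_nonneg_left _ hden0 hden
        linarith only [hT, hh0]

/-- **The competitor arc integrand, pointwise:** for `|θ| ≤ π/2` and the arc left of `1 + δ`:
`‖arcIntegrandU n h c' θ‖ ≤ h · [672·log(T+h)·e^{(4/5)h}·‖γ̃((1+δ)+iT)‖] · [2(T+h+1)/(h(2T−h))^{n+1}]`.
RH-FREE. [folklore] -/
theorem norm_arcIntegrandU_arc_le {x' h T δ : ℝ} (n : ℕ) (hx' : |x'| ≤ 1 / 2) (hh0 : 0 < h)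
    (hH : h ≤ 20) (hT : 1200 ≤ T) (hδ : 0 < δ) (hδ1 : δ ≤ 1) (hleft : 1 / 2 + x' + h ≤ 1 + δ)
    {θ : ℝ} (hθ : |θ| ≤ Real.pi / 2) :
    ‖arcIntegrandU n h ((x' : ℂ) + (T : ℂ) * I) θ‖ ≤
      h * (672 * Real.log (T + h) * Real.exp (4 / 5 * h) *
        ‖xiGammaFactor (((1 + δ : ℝ) : ℂ) + (T : ℂ) * I)‖) *
        (2 * (T + h + 1) / (h * (2 * T - h)) ^ (n + 1)) := by
  have hξ := norm_xiSq_sq_competitor_le (x' := x') (h := h) (T := T) (δ := δ) (θ := θ)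
    hx' hh0 hH hT hδ hδ1 hleft hθ
  have hK := norm_sqKernel_arc_le n hx' hh0 hH hT θ
  rw [arcIntegrandU, norm_mul, norm_mul, deriv_circleMap_eq_I_mul_sub, norm_mul, Complex.norm_I, one_mul,
    circleMap_sub_center, norm_circleMap_zero, abs_of_pos hh0, mul_assoc]
  exact mul_le_mul_of_nonneg_left (mul_le_mul hξ hK (norm_nonneg _)
    (by have := Real.log_nonneg (show (1:ℝ) ≤ T + h by linarith); positivity)) hh0.le

/-- **[SUP] — the competitor half-arc transform:** for a centre `c' = x' + iT` (`|x'| ≤ ½`), radius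
`0 < h ≤ 20`, `T ≥ 1200`, `0 < δ ≤ 1` with `½ + x' + h ≤ 1 + δ`:
`‖U_{n,h}(c')‖ ≤ (n!/2) · (h · [672·log(T+h)·e^{(4/5)h}·‖γ̃((1+δ)+iT)‖] · [2(T+h+1)/(h(2T−h))^{n+1}])`
(`‖(n!/2πi)∫_{−π/2}^{π/2}‖ ≤ (n!/2π)·π·sup`). RH-FREE. [folklore] -/
theorem norm_xiSqArcU_competitor_le {x' h T δ : ℝ} (n : ℕ) (hx' : |x'| ≤ 1 / 2) (hh0 : 0 < h)
    (hH : h ≤ 20) (hT : 1200 ≤ T) (hδ : 0 < δ) (hδ1 : δ ≤ 1) (hleft : 1 / 2 + x' + h ≤ 1 + δ) :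
    ‖xiSqArcU n h ((x' : ℂ) + (T : ℂ) * I)‖ ≤
      (n.factorial : ℝ) / 2 *
        (h * (672 * Real.log (T + h) * Real.exp (4 / 5 * h) *
          ‖xiGammaFactor (((1 + δ : ℝ) : ℂ) + (T : ℂ) * I)‖) *
          (2 * (T + h + 1) / (h * (2 * T - h)) ^ (n + 1))) := by
  set B : ℝ := h * (672 * Real.log (T + h) * Real.exp (4 / 5 * h) *
      ‖xiGammaFactor (((1 + δ : ℝ) : ℂ) + (T : ℂ) * I)‖) *
      (2 * (T + h + 1) / (h * (2 * T - h)) ^ (n + 1)) with hB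
  have hbound : ∀ θ ∈ Set.uIoc (-(Real.pi / 2)) (Real.pi / 2),
      ‖arcIntegrandU n h ((x' : ℂ) + (T : ℂ) * I) θ‖ ≤ B := by
    intro θ hθ
    rw [Set.uIoc_of_le (by linarith [Real.pi_pos])] at hθ
    exact norm_arcIntegrandU_arc_le n hx' hh0 hH hT hδ hδ1 hleft (abs_le.2 ⟨hθ.1.le, hθ.2⟩)
  have hint := intervalIntegral.norm_integral_le_of_norm_le_const hbound
  rw [show Real.pi / 2 - -(Real.pi / 2) = Real.pi by ring, abs_of_pos Real.pi_pos] at hint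
  rw [xiSqArcU, norm_mul]
  have hcoef : ‖(n.factorial : ℂ) / (2 * Real.pi * I)‖ = (n.factorial : ℝ) / (2 * Real.pi) := by
    rw [norm_div, Complex.norm_natCast, norm_mul, norm_mul, Complex.norm_I, mul_one, Complex.norm_ofNat,
      Complex.norm_real, Real.norm_eq_abs, abs_of_pos Real.pi_pos]
  rw [hcoef]
  have hBpos : 0 ≤ B := by
    have h1 : 0 ≤ ‖arcIntegrandU n h ((x' : ℂ) + (T : ℂ) * I) 0‖ := norm_nonneg _
    exact h1.trans (norm_arcIntegrandU_arc_le n hx' hh0 hH hT hδ hδ1 hleft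
      (by rw [abs_zero]; positivity))
  calc (n.factorial : ℝ) / (2 * Real.pi) *
        ‖∫ θ in (-(Real.pi / 2))..(Real.pi / 2), arcIntegrandU n h ((x' : ℂ) + (T : ℂ) * I) θ‖
      ≤ (n.factorial : ℝ) / (2 * Real.pi) * (B * Real.pi) :=
        mul_le_mul_of_nonneg_left hint (by positivity)
    _ = (n.factorial : ℝ) / 2 * B := by field_simp

end Summit.RiemannHypothesis.RiemannHypothesis.Theorems.JensenPolynomials.LogBandArc

end
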